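import Mathlib
import HarnessLib
import Summits.ValiantsHypothesis.ValiantsHypothesis.Theses.MonotoneRestoration
import Literature.Computability.AlgebraicComplexity.ArithCircuit
import Literature.Computability.AlgebraicComplexity.ArithCircuitProofs
import Literature.Computability.AlgebraicComplexity.MonotoneStructure
import Literature.Computability.AlgebraicComplexity.PermanentIrreducible
import Literature.ModelTheory.FiniteModelTheory.CkEquiv
import Summits.ValiantsHypothesis.ValiantsHypothesis.Theorems.MonotoneRestorationMonotoneRestorationQPCosetCount
import Summits.ValiantsHypothesis.ValiantsHypothesis.Theorems.MonotoneRestorationMonotoneRestorationQPSymmetricLB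
import Summits.ValiantsHypothesis.ValiantsHypothesis.Theorems.MonotoneRestorationMonotoneRestorationQPSupportSymmetrisation
import Summits.ValiantsHypothesis.ValiantsHypothesis.Theorems.MonotoneRestorationMonotoneRestorationQPSparseRegime
import Summits.ValiantsHypothesis.ValiantsHypothesis.Theorems.MonotoneRestorationMonotoneRestorationQPBeta
import Literature.Computability.AlgebraicComplexity.SymmetricArithCircuit
import Literature.Computability.AlgebraicComplexity.DawarWilsenach2025Proofs
import Literature.GroupTheory.PermutationGroups.SmallIndexSubgroups
import Summits.ValiantsHypothesis.ValiantsHypothesis.Theorems.MonotoneRestorationQP.Negative.LoadBearing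
import Summits.ValiantsHypothesis.ValiantsHypothesis.Theorems.MonotoneRestorationMonotoneRestorationQPPermSupportCount

/-! TTRL-lite variant V14626 of stmt-ValiantsHypothesis-15886

Variant `fix_nat:d=2` of `stub_symmetricMonotone_choose_le_card` (THEOREM γ of the line of crux
`MonotoneRestorationQP`). With the degree fixed to `d = 2` the side conditions `2 ≤ k` and
`k * k ≤ 2` are jointly unsatisfiable (`2 ≤ k` forces `4 ≤ k * k`), so the specialised statement
holds vacuously; no circuit reasoning is needed.
-/

-- `Summit.ValiantsHypothesis.ValiantsHypothesis.…` is the tree's mandated single-conjunct layout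
-- (Sub = Summit), so the duplicated namespace component is intended.
set_option linter.dupNamespace false

namespace Summit.ValiantsHypothesis.ValiantsHypothesis.Theorems

open Summit.ValiantsHypothesis.ValiantsHypothesis.Theses.MonotoneRestoration
open Literature.Computability.AlgebraicComplexity

/-- **TTRL-lite variant V14626 (`d := 2`) of `stub_symmetricMonotone_choose_le_card`.**
For a `Sym_n`-symmetric labelled arithmetic circuit over `ℝ≥0` on the matrix variables
`Fin n × Fin n` whose output is a nonzero homogeneous row-multilinear polynomial of degree `2`,
the gate-count bound `C(n, k) ≤ |G|` under the side conditions `2 ≤ k`, `4k ≤ n`, `k * k ≤ 2`,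
`2 + k + 9 ≤ n`, `n > 8`. The hypotheses `2 ≤ k` and `k * k ≤ 2` are contradictory
(`2 ≤ k` gives `4 ≤ k * k`), so the statement is vacuously true. -/
theorem stub_symmetricMonotone_choose_le_card_var14626 :
    ∀ (n : ℕ) (G : Type) [Fintype G] (C : LabelledArithCircuit NNReal (Fin n × Fin n) Unit G)
      (hC : C.IsSymmetric (Equiv.Perm (Fin n))) (k : ℕ)
      (hhom : (C.eval (C.output ())).IsHomogeneous 2) (h0 : C.eval (C.output ()) ≠ 0)
      (hrow : ∀ m ∈ (C.eval (C.output ())).support, ∀ i : Fin n, rowDegrees m i ≤ 1)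
      (hn : 8 < n) (hk : 2 ≤ k) (h4k : 4 * k ≤ n) (hkd : k * k ≤ 2) (hdk : 2 + k + 9 ≤ n),
      n.choose k ≤ Fintype.card G := by
  intro n G _ C _hC k _hhom _h0 _hrow _hn hk _h4k hkd _hdk
  exfalso
  have h4 : 2 * 2 ≤ k * k := Nat.mul_le_mul hk hk
  omega

end Summit.ValiantsHypothesis.ValiantsHypothesis.Theorems
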